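import Mathlib.Data.Matrix.Mul
import Mathlib.Data.Matrix.Basic
import Mathlib.Analysis.SpecialFunctions.Pow.Real
import Literature.Computability.Complexity.KWProtocol

/-!
# Strategist sketch (gen 1) — ONE HONEST SUBTRACTION: shadows of unambiguous differences

First lemmas for the crux idea `one-honest-subtraction` on the crux
`Summit.ValiantsHypothesis.ValiantsHypothesis.Theses.ShallowShadows.ShadowFormulaTransfer`.

Objects. A *layered automaton* of length `n`, alphabet `Fin q`, width `w`: transition matrices
`M i σ : Matrix (Fin w) (Fin w) ℕ` (position `i`, letter `σ`), initial / final weight vectors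
`u v : Fin w → ℕ`. Its word polynomial is `R = ∑_word pathCount(word) · ∏ᵢ x_{i, word i}`;
it is UNAMBIGUOUS when every word has path count `≤ 1` (then `R` has 0/1 coefficients and a
monotone read-once oblivious ABP of width `w`). All statements carry `0 < n`, `0 < q`
(otherwise the coordinate type `Fin n × Fin q` is empty and no protocol tree exists — vacuity guard). For two such automata with `pathCount₂ ≤ pathCount₁`
the difference `g = R₁ − R₂` is a 0/1 polynomial in VP (iterated matrix product) with GENUINE
cancellation (e.g. `R₁ = all words`, `R₂ =` a UFA language `L`: `g = 1_{Lᶜ}`), and its shadow is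
`udiffShadow` below: "the box `a ⊆ Fin n × Fin q` contains a word of `L₁ ∖ L₂`".

* `UDiffWidthBound` (PROVABLE NOW, the rung): monotone KW depth
  `≤ ⌈log₂ n⌉·(w₁+w₂+1) + ⌈log₂ q⌉` by hybrid binary search with the COUNT test
  `#(L₁∖L₂)-words in {w_<i} × Box(b)_≥i ≥ 1`, which Bob evaluates from Alice's two reach-SUPPORTS
  (0/1 by unambiguity: a state reached twice by a prefix accepts no suffix) — positivity + unambiguity.
* `UDiffShallow` (OPEN, two-sided decisive): the same with `n^{1-δ}·polylog(n q w)` in place of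
  `w·log n`; a poly-parameter counterexample refutes `ShadowFormulaTransfer` (padding normal form,
  Disproof §3.3), a proof is the first Q−R lemma with cancellation beyond width `n^{1-δ}`.
* `ComplementWitnessBound` (PROVABLE NOW): the NFA ⇒ protocol half of the dictionary.
* `UComplementShallow` (OPEN): the one-automaton case `R₁ = all words` (box-non-containment for a
  UFA language). Dictionary (card §Transfer): depth ≤ ⌈log₂ n⌉·(⌈log₂ W⌉+1) + ⌈log₂ q⌉ with `W` the
  width of a layered NFA for the complement, so a refutation forces super-quasi-polynomial
  layered-UFA complementation (beyond Göös–Kiefer–Yuan 2022).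

Card: `Cruxes/ShadowFormulaTransfer/Ideas/one-honest-subtraction.md` (strategist gen 1). This file
(`Cruxes/ShadowFormulaTransfer/OneHonestSubtraction.lean`) is a
typed-statement sketch, NOT a registered skeleton line (no `_of` composition to the crux exists or is claimed).
-/

namespace Summit.ValiantsHypothesis.ValiantsHypothesis.Cruxes.ShadowFormulaTransfer.UDiff

open Literature.Computability.Complexity

/-- Path count of `word` in the layered automaton `(M, u, v)`: `uᵀ · M₀(word 0) ⋯ M_{n-1}(word (n-1)) · v`. -/
def pathCount {n q w : ℕ} (M : Fin n → Fin q → Matrix (Fin w) (Fin w) ℕ) (u v : Fin w → ℕ)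
    (word : Fin n → Fin q) : ℕ :=
  dotProduct u (((List.ofFn fun i : Fin n => M i (word i)).prod).mulVec v)

/-- Unambiguity: every word has at most one weighted path. -/
def Unambiguous {n q w : ℕ} (M : Fin n → Fin q → Matrix (Fin w) (Fin w) ℕ) (u v : Fin w → ℕ) : Prop :=
  ∀ word : Fin n → Fin q, pathCount M u v word ≤ 1

/-- The shadow of the unambiguous difference `R₁ − R₂` as a monotone Boolean function of the box
`a : Fin n × Fin q → Bool`: some word inside the box is accepted by automaton 1 and not by 2. -/
def udiffShadow {n q w₁ w₂ : ℕ}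
    (M₁ : Fin n → Fin q → Matrix (Fin w₁) (Fin w₁) ℕ) (u₁ v₁ : Fin w₁ → ℕ)
    (M₂ : Fin n → Fin q → Matrix (Fin w₂) (Fin w₂) ℕ) (u₂ v₂ : Fin w₂ → ℕ)
    (a : Fin n × Fin q → Bool) : Bool :=
  decide (∃ word : Fin n → Fin q, (∀ i, a (i, word i) = true) ∧
    pathCount M₁ u₁ v₁ word = 1 ∧ pathCount M₂ u₂ v₂ word = 0)

/-- **Rung (provable): unambiguous-difference shadows have monotone KW depth `O((w₁+w₂) log n + log q)`.**
Hybrid binary search over positions with Bob's count test; Alice's messages are her two reach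
supports (at most `w₁ + w₂` bits per round), Bob answers one bit; finally Alice names her letter. -/
def UDiffWidthBound : Prop :=
  ∀ (n q w₁ w₂ : ℕ) (M₁ : Fin n → Fin q → Matrix (Fin w₁) (Fin w₁) ℕ) (u₁ v₁ : Fin w₁ → ℕ)
    (M₂ : Fin n → Fin q → Matrix (Fin w₂) (Fin w₂) ℕ) (u₂ v₂ : Fin w₂ → ℕ),
    0 < n → 0 < q → Unambiguous M₁ u₁ v₁ → Unambiguous M₂ u₂ v₂ →
    (∀ word, pathCount M₂ u₂ v₂ word ≤ pathCount M₁ u₁ v₁ word) →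
    ∃ P : KWTree (Fin n × Fin q), P.SolvesMono (udiffShadow M₁ u₁ v₁ M₂ u₂ v₂) ∧
      P.depth ≤ Nat.clog 2 n * (w₁ + w₂ + 1) + Nat.clog 2 q

/-- **Open core (two-sided decisive for the crux): UDiffShallow.** The same class with the crux's
budget: depth `≤ n^{1-δ} · (log (n q (w₁+w₂) + 2))^C + C`, uniformly. A counterexample with
`q, w ≤ poly(n)` and depth `≥ n^{1-o(1)}` refutes `ShadowFormulaTransfer`; a proof settles the crux on
every 0/1 VP family of this (cancellation-bearing) shape. -/
def UDiffShallow : Prop :=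
  ∃ δ : ℝ, 0 < δ ∧ ∃ C : ℕ,
  ∀ (n q w₁ w₂ : ℕ) (M₁ : Fin n → Fin q → Matrix (Fin w₁) (Fin w₁) ℕ) (u₁ v₁ : Fin w₁ → ℕ)
    (M₂ : Fin n → Fin q → Matrix (Fin w₂) (Fin w₂) ℕ) (u₂ v₂ : Fin w₂ → ℕ),
    0 < n → 0 < q → Unambiguous M₁ u₁ v₁ → Unambiguous M₂ u₂ v₂ →
    (∀ word, pathCount M₂ u₂ v₂ word ≤ pathCount M₁ u₁ v₁ word) →
    ∃ P : KWTree (Fin n × Fin q), P.SolvesMono (udiffShadow M₁ u₁ v₁ M₂ u₂ v₂) ∧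
      (P.depth : ℝ) ≤ (n : ℝ) ^ (1 - δ) * (Real.log ((n : ℝ) * q * (w₁ + w₂) + 2)) ^ C + C

/-- The special case most worth attacking first on BOTH sides: complements of one UFA language
(`R₁ =` all words, width 1). `UDiffShallow → UComplementShallow` is immediate; the disprover's
target is `¬ UComplementShallow` via a poly-width UFA whose box-non-containment game is deep. -/
def UComplementShallow : Prop :=
  ∃ δ : ℝ, 0 < δ ∧ ∃ C : ℕ,
  ∀ (n q w : ℕ) (M : Fin n → Fin q → Matrix (Fin w) (Fin w) ℕ) (u v : Fin w → ℕ),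
    0 < n → 0 < q → Unambiguous M u v →
    ∃ P : KWTree (Fin n × Fin q),
      P.SolvesMono (fun a => decide (∃ word : Fin n → Fin q,
        (∀ i, a (i, word i) = true) ∧ pathCount M u v word = 0)) ∧
      (P.depth : ℝ) ≤ (n : ℝ) ^ (1 - δ) * (Real.log ((n : ℝ) * q * w + 2)) ^ C + C

/-- The dictionary of the card's §Transfer (PROVABLE NOW): a layered NFA `(N, u', v')` of width `W`
recognising exactly the complement of the language of `(M, u, v)` on length-`n` words gives the
box-non-containment game depth `≤ ⌈log₂ n⌉ · (⌈log₂ W⌉ + 1) + ⌈log₂ q⌉` (Alice's accepting complement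
run vs Bob's box-reachable state sets, binary search on "state `r_i` is box-reachable"). Contrapositive:
a depth lower bound `D` forces complement width `W ≥ 2 ^ (D / ⌈log₂ n⌉ - O(1))`. No unambiguity needed. -/
def ComplementWitnessBound : Prop :=
  ∀ (n q w W : ℕ) (M : Fin n → Fin q → Matrix (Fin w) (Fin w) ℕ) (u v : Fin w → ℕ)
    (N : Fin n → Fin q → Matrix (Fin W) (Fin W) ℕ) (u' v' : Fin W → ℕ),
    0 < n → 0 < q →
    (∀ word : Fin n → Fin q, pathCount M u v word = 0 ↔ 0 < pathCount N u' v' word) →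
    ∃ P : KWTree (Fin n × Fin q),
      P.SolvesMono (fun a => decide (∃ word : Fin n → Fin q,
        (∀ i, a (i, word i) = true) ∧ pathCount M u v word = 0)) ∧
      P.depth ≤ Nat.clog 2 n * (Nat.clog 2 W + 1) + Nat.clog 2 q

/-- Sanity: the all-words automaton (width 1, all-ones data) is unambiguous with path count 1. -/
example (n q : ℕ) (word : Fin n → Fin q) :
    pathCount (fun (_ : Fin n) (_ : Fin q) => (1 : Matrix (Fin 1) (Fin 1) ℕ)) (fun _ => 1) (fun _ => 1) word = 1 := by
  simp [pathCount, dotProduct]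

end Summit.ValiantsHypothesis.ValiantsHypothesis.Cruxes.ShadowFormulaTransfer.UDiff
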